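import Summits.ResolutionOfSingularities.ResolutionOfSingularities.Theorems.ValuativeLuAlphaPTorsorBirationalExit
import Summits.ResolutionOfSingularities.ResolutionOfSingularities.Theorems.ValuativeLupiAbhyankarPlaces
import Literature.AlgebraicGeometry.Resolution.AbhyankarEtaleAscentProofs
import Literature.AlgebraicGeometry.Resolution.SmoothImpliesRegular
import HarnessLib

/-!
# The crux `Valuative.LuAlphaPTorsor` along Abhyankar places
# (stmt-ResolutionOfSingularities-0641, line `pfaff-line-log-final-forms`, stub `stub_abhyankarPlace`)

Setting: `k` a field of characteristic `p`, `K ⊇ k` a field, `O` a valuation ring of `K`,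
`A₀ ⊆ O` a finitely generated `k`-subalgebra, `t ∈ K` with `t ^ p ∈ A₀` and `Frac (A₀[t]) = K`.

**Claim** (`stub_abhyankarPlace`). If `O` is an ABHYANKAR place of `K/k` (equality in
Abhyankar's inequality, `IsAbhyankarPlace O (im k) ⊤`) whose residue field extension is
separably generated (`SeparablyGeneratedOver`), then there is a finitely generated `A ⊇ A₀[t]`
inside `O` with `Frac A = K`, regular at the centre `𝔪_O ∩ A` — in every dimension and every
characteristic, and without using the regularity of `A₀` or the torsor shape beyond `t ∈ O`.

Proof. `K = k(Z)` for the finite set `Z = {t} ∪ {generators of A₀} ⊆ O`. Knaf–Kuhlmann 2005,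
Thm. 1.1 (PROVED in the tree: `KnafKuhlmann2005_Thm11_holds`) uniformizes the pair `(O, Z)` on an
affine model `A'` of `K` over `im k`, SMOOTH over the field at the centre, with `Z` inside the
local ring `A'_𝔮 ⊆ K`; smooth over a field at a prime ⇒ the local ring is regular (EGA IV 17.5.8,
PROVED in the tree: `isRegularLocalRing_of_isSmoothAt`). Put `A := A' ⊔ A₀[t]` (the same subring
`A'` viewed as a `k`-subalgebra): `A' ⊆ A ⊆ A'_𝔮`, so the local rings of `A` and `A'` at the
centre coincide inside `K` (Novacoski–Spivakovsky 2014, Lemma 2.5 (1): `centreLocalization_le`)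
and regularity transfers (`isRegularLocalRing_of_centreLocalization_eq`).

This is a port of the kernel-checked `concl_of_isAbhyankarPlace` of
`Cruxes/LuAlphaPTorsor/Disproof.lean` §3d (not importable from `Theorems/`); the bridge lemma
`adjoin_fieldRange_toSubring` is reused from `Theorems/ValuativeLupiAbhyankarPlaces.lean`.

Log: (1) direct port.
-/

-- single-problem summit: the doubled namespace component `ResolutionOfSingularities` is forced
set_option linter.dupNamespace false

open IsLocalRing

namespace Summit.ResolutionOfSingularities.ResolutionOfSingularities.Theorems.PfaffLine

open Literature.AlgebraicGeometry.Resolution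
open Summit.ResolutionOfSingularities.ResolutionOfSingularities.Theorems.Lupi
  (adjoin_fieldRange_toSubring)

-- adapted from Cruxes/LuAlphaPTorsor/Disproof.lean (§3d `concl_of_isAbhyankarPlace`)
/-- **The crux along every ABHYANKAR place with separably generated residue field extension,
in every dimension and every characteristic — unconditionally** (`stub_abhyankarPlace` of line
`pfaff-line-log-final-forms`): Knaf–Kuhlmann 2005, Thm. 1.1 (`KnafKuhlmann2005_Thm11_holds`)
uniformizes `(O, Z)`, `Z` = `t` and the generators of `A₀`, on a model smooth over `im k` at the
centre with `Z` in the local ring; smooth ⇒ regular (`isRegularLocalRing_of_isSmoothAt`);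
adjoining `A₀[t]` to that model does not change the local ring at the centre
(Novacoski–Spivakovsky 2014, Lemma 2.5 (1)). -/
theorem stub_abhyankarPlace :
    ∀ p : ℕ, p.Prime → ∀ (k K : Type) [Field k] [CharP k p] [Field K] [Algebra k K] (O : ValuationSubring K) (A₀ : Subalgebra k K) (h₀ : A₀.toSubring ≤ O.toSubring) (t : K), A₀.FG → t ^ p ∈ A₀ → IsFractionRing (Algebra.adjoin k (insert t (A₀ : Set K))) K → Literature.AlgebraicGeometry.Resolution.IsAbhyankarPlace O (algebraMap k K).fieldRange ⊤ → Literature.AlgebraicGeometry.Resolution.SeparablyGeneratedOver (Literature.AlgebraicGeometry.Resolution.resField O (algebraMap k K).fieldRange) (Literature.AlgebraicGeometry.Resolution.resField O ⊤) → ∃ (A : Subalgebra k K) (h : A.toSubring ≤ O.toSubring), A₀ ≤ A ∧ t ∈ A ∧ A.FG ∧ IsFractionRing A K ∧ IsRegularLocalRing (Localization.AtPrime (Ideal.comap (Subring.inclusion h) (IsLocalRing.maximalIdeal O))) := by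
  intro p hp k K _ _ _ _ O A₀ h₀ t hfg htp hfr hAbh hsep
  classical
  -- `t ∈ O`: valuation rings are integrally closed
  have htO : t ∈ O := mem_valuationSubring_of_pow_mem O hp.ne_zero (h₀ htp)
  set Kf : Subfield K := (algebraMap k K).fieldRange with hKf
  set R : Subalgebra k K := Algebra.adjoin k (insert t (A₀ : Set K)) with hR
  have hRO : R.toSubring ≤ O.toSubring := adjoin_insert_toSubring_le O.toSubring A₀ h₀ htO
  haveI hfrR : IsFractionRing R K := hfr
  obtain ⟨s, hs⟩ := hfg
  -- the finite set of generators of `A₀[t]`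
  set Z : Finset K := insert t s with hZ
  have hRZ : R = Algebra.adjoin k (Z : Set K) := by
    rw [hR, ← hs, Algebra.adjoin_insert_adjoin, hZ, Finset.coe_insert]
  have hZO : ∀ z ∈ Z, z ∈ O ∧ z ∈ (⊤ : Subfield K) := by
    intro z hz
    refine ⟨?_, Subfield.mem_top z⟩
    rw [hZ, Finset.mem_insert] at hz
    rcases hz with rfl | hz
    · exact htO
    · exact h₀ (hs ▸ Algebra.subset_adjoin hz)
  -- `K/k` is finitely generated: `K = k(Z)`
  have hKfg : FGOver Kf (⊤ : Subfield K) := by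
    refine ⟨Z, top_le_iff.mp fun z _ => ?_⟩
    let F : Subalgebra k K :=
      { (Subfield.closure ((Kf : Set K) ∪ ↑Z)).toSubring with
        algebraMap_mem' := fun c => Subfield.subset_closure (Or.inl ⟨c, rfl⟩) }
    have hRF : R ≤ F := by
      rw [hRZ]
      exact Algebra.adjoin_le fun x hx => Subfield.subset_closure (Or.inr hx)
    obtain ⟨a, b, -, rfl⟩ := IsFractionRing.div_surjective (A := R) z
    exact div_mem (hRF a.2) (hRF b.2)
  have hKO : ((Kf : Subfield K) : Set K) ⊆ O := by
    rintro _ ⟨c, rfl⟩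
    exact h₀ (A₀.algebraMap_mem c)
  -- Knaf–Kuhlmann 2005, Thm. 1.1 (PROVED in the tree)
  obtain ⟨A', hA'O, -, hfp, hfrac', hsm, hZA⟩ :=
    KnafKuhlmann2005_Thm11_holds K O Kf ⊤ le_top hKfg hKO hAbh hsep Z hZO
  haveI := hfp
  haveI := hsm
  -- smooth over a field at the centre ⇒ regular local ring (EGA IV 17.5.8, PROVED in the tree)
  have hreg' : IsRegularLocalRing (Localization.AtPrime (centre A' O hA'O)) :=
    isRegularLocalRing_of_isSmoothAt Kf A' (centre A' O hA'O)
  -- the same model as a `k`-subalgebra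
  let A'' : Subalgebra k K :=
    { A'.toSubring with
      algebraMap_mem' := fun c => A'.algebraMap_mem ⟨algebraMap k K c, ⟨c, rfl⟩⟩ }
  have hA''O : A''.toSubring ≤ O.toSubring := hA'O
  have hreg'' : IsRegularLocalRing (Localization.AtPrime
      ((maximalIdeal O).comap (Subring.inclusion hA''O))) := hreg'
  have hA''fg : A''.FG := by
    haveI : Algebra.FiniteType Kf A' := inferInstance
    obtain ⟨s', hs'⟩ := A'.fg_iff_finiteType.mpr this
    refine ⟨s', Subalgebra.toSubring_injective ?_⟩
    rw [← adjoin_fieldRange_toSubring, hs']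
  haveI hfrA'' : IsFractionRing A''.toSubring K := by
    refine IsFractionRing.of_field A''.toSubring K fun z => ?_
    obtain ⟨a, ha, b, hb, rfl⟩ := hfrac' z (Subfield.mem_top z)
    exact ⟨⟨a, ha⟩, ⟨b, hb⟩, rfl⟩
  -- `Z`, hence `R = k[Z]`, lies in the local ring `Λ = A''_𝔮 ⊆ K`
  set Λ : Subalgebra A''.toSubring K := Localization.subalgebra.ofField K
    ((maximalIdeal O).comap (Subring.inclusion hA''O)).primeCompl
    (Ideal.primeCompl_le_nonZeroDivisors _) with hΛ
  have hZΛ : ∀ z ∈ Z, z ∈ Λ := by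
    intro z hz
    obtain ⟨a, ha, b, hb, hb1, rfl⟩ := hZA z hz
    rw [hΛ, mem_centreLocalization_iff]
    exact ⟨a, ha, b, hb, hb1, div_eq_mul_inv a b⟩
  let Λk : Subalgebra k K :=
    { Λ.toSubring with
      algebraMap_mem' := fun c => le_centreLocalization O A'' hA''O (A''.algebraMap_mem c) }
  have hRΛ : (R : Set K) ⊆ Λ := by
    change R ≤ Λk
    rw [hRZ]
    exact Algebra.adjoin_le fun z hz => hZΛ z hz
  -- the model `A = A'' ⊔ R = A''[Z]`
  set A : Subalgebra k K := A'' ⊔ R with hA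
  have hAO : A.toSubring ≤ O.toSubring := by
    let Oalg : Subalgebra k K :=
      { O.toSubring with algebraMap_mem' := fun c => h₀ (A₀.algebraMap_mem c) }
    change A ≤ Oalg
    exact sup_le (fun x hx => hA''O hx) (fun x hx => hRO hx)
  have hRA : R ≤ A := le_sup_right
  haveI : IsFractionRing R.toSubring K := hfr
  have hfrA : IsFractionRing A K := isFractionRing_subalgebra_of_le R A hRA
  haveI : IsFractionRing A.toSubring K := hfrA
  have hAΛ : (A : Set K) ⊆ Λ := by
    change A ≤ Λk
    exact sup_le (fun x hx => le_centreLocalization O A'' hA''O hx) (fun x hx => hRΛ hx)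
  have heq : ((Localization.subalgebra.ofField K
      ((maximalIdeal O).comap (Subring.inclusion hAO)).primeCompl
      (Ideal.primeCompl_le_nonZeroDivisors _)) : Set K) = Λ :=
    le_antisymm (centreLocalization_le O A A'' hAO hA''O hAΛ)
      (centreLocalization_le O A'' A hA''O hAO fun x hx =>
        le_centreLocalization O A hAO (le_sup_left (a := A'') hx))
  refine ⟨A, hAO, (le_adjoin_insert A₀ t).trans hRA, hRA (mem_adjoin_insert A₀ t),
    hA''fg.sup (fg_adjoin_insert ⟨s, hs⟩ t), hfrA, ?_⟩
  exact isRegularLocalRing_of_centreLocalization_eq O A A'' hAO hA''O heq hreg''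

end Summit.ResolutionOfSingularities.ResolutionOfSingularities.Theorems.PfaffLine
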